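/-
COR-CM (cell pub-hodgecm2) — RSCONJ row Ω (A7, the ω-LABEL face of the μ ↦ μᶜ identification), ROUTE C
(`HOME/d2bridge/ident/ident-1/omega/OMEGA-ROUTE-C.md` §6 (M) SPEC): the `uniformOmegaRep`-LEVEL corollary of Parts I–IV.
Seat prover-pub-hodgeaudit-ident-1-g3-0 (ident-1 GEN 3), checker ident-2, 2026-08-24.  PART V (RecordSystemConjOmegaTwistUniform).
KERNEL ONLY: theorems; no definition, no named fact, no instance, no `sorry`.  HC_CM is NOT proved; HELD — WORLD = C FINAL;
nothing displayed by an END is discharged here; the LABEL equation `hlabel` is an explicit HYPOTHESIS (pen mukey-p1, (C3′)).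
v3 (filer rsconj-p4 g0, 2026-08-24 12:30Z): ident-1 v2 056379f6b0b83608 with the two `variable (h : exists_recordSystem) …` section blocks of §§ Uniform∕Model turned into EXPLICIT theorem binders in the same order (tonight filing rule «explicit binders, no section variable (h : named fact)»); statements and proofs otherwise byte-identical; the three elaborated types are kernel-`rfl`-equal to v2ʼs (twin probe).
-/
import Summits.HodgeConjecture.CorCM.B01.Transposition.HComp.RecordSystemConjOmegaTwistAssembly
import Summits.HodgeConjecture.CorCM.B01.Transposition.Item6UniformOmegaRep
import HarnessLib

set_option autoImplicit false

/-!
# The θ-twist of the unitary dual-pair Weil carriers, V: at the model's μ-uniform family `uniformOmegaRep`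

For the μ-UNIFORM Weil carriers of the model `𝕌 := Model.uniformOmegaRep h F ι₁ V Φ e dV hdV hdV0 ιV δ′ r` ([Liu2021, Def. 4.11 ∕ 4.12] at a real
diagonal frame `dV` with `ιV : 𝔾 →* U(diag dV)(𝔸_{F⁺,f})`; `𝕌.omega μ hμ ε χ = omegaAtLine … (hsChiD … (toHeckeCharacter F μ) …) ((r μ hμ) ε) χ`
by construction) and a conjugate-symplectic `ν`, GIVEN the label equation of (C3′)
`hlabel : conjFamily (a ↦ sChiD … (toHeckeCharacter F ν) … a) = (a ↦ sChiD … (toHeckeCharacter F νᶜ) … a)` (`νᶜ = galConj c ν`):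

* **`exists_omegaConjEquiv_uniformOmegaRep`** — for every identification `ιV′ : G′ →* U(diag dV)(𝔸_{F⁺,f})` and map `φ : 𝔾 → G′` with
  `ιV′ (φ g) = \overline{ιV g}`, and every `(ε, χ)`: a `ℂ`-LINEAR isomorphism
  `Ω′ : 𝕌.omega νᶜ hν.galConj ε χ ≃ₗ[ℂ] omegaAtLine … (hsChiD … (toHeckeCharacter F ν) …) (−(r νᶜ _ ε)) (chiInv χ)` with
  `Ω′ (𝕌.rho νᶜ … g x) = rhoAtLine … (hsChiD … ν …) ιV′ (−(r νᶜ _ ε)) (chiInv χ) (φ g) (Ω′ x)` — the carrier of the family OF RECORD at the label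
  `νᶜ`, read along `g ↦ ḡ`, IS the carrier of the conjugate datum's own Def-4.11 family at the label `ν` and the D_BMM index `(−ε, χ⁻¹)`
  (same frame `dV`; the right-hand side is `𝕌ᶜ.omega ν hν εᶜ (chiInv χ)` for the conjugate space's family `𝕌ᶜ := uniformOmegaRep … V.conj … dV … ιV′ … rᶜ`
  as soon as `(rᶜ ν hν) εᶜ = −(r νᶜ hν.galConj) ε`, by `rfl` — the (M) wrapper, after row B).
* **`exists_uniformOmegaRep_conj`** (§3, ident-2's blind spec `OmegaMSpec` 4dd48bba54a0bacb verbatim + `hlabel`): TWO face data over the same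
  frame, `φ : 𝔾_V →* 𝔾_{V′}` entrywise conjugation (`hφ`), `hε : r′_ν(ε′) = −r_{νᶜ}(ε)`, `hχ : χ′ = χ⁻¹` ⟹
  `∃ Ω : 𝕌_V.omega νᶜ _ ε χ ≃ₗ[ℂ] 𝕌_{V′}.omega ν _ ε′ χ′` equivariant along `φ` — A7 in kernel form at one frame, modulo (C3′).

References: [Liu2021] Def. 4.11 (l. 2083–2097), Def. 4.12 (l. 2102–2111), Rem. 4.4 (l. 1912–1933), App. D Lem. D.1 (2) (l. 5231);
[GelbartRogawski1991] §3.1 Prop. 3.1.1 p. 455, Remark p. 457; [Kudla1996] V.3.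
-/

noncomputable section

open scoped Matrix Kronecker
open NumberField IsDedekindDomain
open Literature.RepresentationTheory.HeisenbergGroup
open Literature.NumberTheory.Automorphic Literature.NumberTheory.Automorphic.UnitaryGroup
open Literature.NumberTheory.Automorphic.IdeleClassGroup
open Literature.NumberTheory.Weil1964
open Literature.NumberTheory.GelbartRogawski1991 Literature.NumberTheory.GelbartRogawski1991.UnitaryDualPair
open Literature.NumberTheory.GelbartRogawski1991.UnitaryDualPair.WeilCoinv
open Literature.RepresentationTheory
open Literature.AlgebraicGeometry.Motives (CMType)
open Literature.AlgebraicGeometry.ShimuraVarieties.UnitaryCanonicalModel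
open Literature.NumberTheory.Automorphic.Liu2021.Def411WeilCarriers (TW JW JW_eq isSymm_TW isUnit_det_TW Chi lineChar Rep
  lineChar_finAdelicCenter lineCenterEquiv lineCenterEquiv_apply IsAutomorphicOneChar omegaAtLine rhoVAtLine rhoAtLine rhoAtLine_apply)
open Summit.HodgeConjecture.CorCM.Transposition Summit.HodgeConjecture.CorCM.Transposition.OmegaChiSplitting
open Summit.HodgeConjecture.CorCM.Model
open Literature.RepresentationTheory.Liu2021 (isOscillatorChar_toHeckeCharacter_iff)

namespace Summit.HodgeConjecture.CorCM.HComp.OmegaConj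

section Label

variable (F E : Type) [Field F] [NumberField F] [Field E] [NumberField E] [Algebra F E]
variable (c : E ≃ₐ[F] E) (N : ℕ) {n : ℕ} (e : Fin N × Fin 1 ≃ Fin n)
variable (JV : Matrix (Fin N) (Fin N) E) {TV : Matrix (Fin N) (Fin N) F}
variable [Algebra.IsQuadraticExtension F E] {δ : E} (hcδ : c δ = -δ) (hδ : δ ≠ 0) {d : F}
  (hd : δ * δ = algebraMap F E d) (hV : TV.IsSymm) (hVd : IsUnit TV.det) (hJV : JV = TV.map (algebraMap F E))

/-- abstract bookkeeping: if `T : M₂ ≃ M₁` intertwines `ρ₂` with `ρ₁` and `Ω : M₂ ≃ M₃` intertwines `ρ₂` with `ρ₃`, then `Ω ∘ T⁻¹`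
intertwines `ρ₁` with `ρ₃` (kept abstract so that no unifier ever compares two carriers' telescopes). [folklore] -/
theorem symm_trans_intertwine {M₁ M₂ M₃ : Type*} [AddCommGroup M₁] [AddCommGroup M₂] [AddCommGroup M₃] [Module ℂ M₁]
    [Module ℂ M₂] [Module ℂ M₃] (T : M₂ ≃ₗ[ℂ] M₁) (Ω : M₂ ≃ₗ[ℂ] M₃) (ρ₁ : M₁ → M₁) (ρ₂ : M₂ → M₂) (ρ₃ : M₃ → M₃)
    (hT : ∀ y, T (ρ₂ y) = ρ₁ (T y)) (hΩ : ∀ y, Ω (ρ₂ y) = ρ₃ (Ω y)) (x : M₁) :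
    (T.symm.trans Ω) (ρ₁ x) = ρ₃ ((T.symm.trans Ω) x) := by
  rw [LinearEquiv.trans_apply, LinearEquiv.trans_apply, ← hΩ]
  congr 1
  rw [LinearEquiv.symm_apply_eq, hT, LinearEquiv.apply_symm_apply]

/-- **Ω modulo a label equation, at the level of Liu's carriers.**  For a compatible family `s` and ANY family `s′` with
`(a ↦ conjFamily s a) = s′` (e.g. the (C3′) label `conjFamily (sChiD μ) = sChiD μᶜ`) and any compatibility proof `hs′` of `s′`:
`ω(s′; a; χ) ≃ₗ[ℂ] ω(s; −a; χ⁻¹)` intertwining `rhoVAtLine hs′ a χ k` with `rhoVAtLine hs (−a) χ⁻¹ k̄` (= `omegaAtLineCongr⁻¹ ≫ omegaConjEquiv`).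
[cite: Liu2021, Def. 4.11 (l. 2092–2096), App. D Lem. D.1 (2) (l. 5231)] [cite: GelbartRogawski1991, §3.1 Remark p. 457] -/
theorem exists_omegaConjEquiv_of_label (hc : c * c = 1)
    {s : ∀ a : Fˣ, adelicPair F E c N 1 JV (JW F E a) →* adelicMpCont F (Fin n) (adelicGram F e TV (TW F a))}
    (hs : ∀ a : Fˣ, (splittingDatum F E c N 1 e JV (JW F E a) hcδ hδ hd hV (isSymm_TW F a) hVd (isUnit_det_TW F a) hJV
      (JW_eq F E a)).IsCompatible (s a))
    {s' : ∀ a : Fˣ, adelicPair F E c N 1 JV (JW F E a) →* adelicMpCont F (Fin n) (adelicGram F e TV (TW F a))}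
    (h : (fun a => conjFamily F E c N e JV hJV s a) = s')
    (hs' : ∀ a : Fˣ, (splittingDatum F E c N 1 e JV (JW F E a) hcδ hδ hd hV (isSymm_TW F a) hVd (isUnit_det_TW F a) hJV
      (JW_eq F E a)).IsCompatible (s' a)) (a : Fˣ) (χ : Chi F E c) :
    ∃ Ω' : omegaAtLine F E c N e JV hcδ hδ hd hV hVd hJV hs' a χ ≃ₗ[ℂ]
        omegaAtLine F E c N e JV hcδ hδ hd hV hVd hJV hs (-a) (chiInv F E c χ),
      ∀ (k : finAdelic F E c N JV) (x : omegaAtLine F E c N e JV hcδ hδ hd hV hVd hJV hs' a χ),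
        Ω' (rhoVAtLine F E c N e JV hcδ hδ hd hV hVd hJV hs' a χ k x) =
          rhoVAtLine F E c N e JV hcδ hδ hd hV hVd hJV hs (-a) (chiInv F E c χ) (finConjV F E c N JV hJV k) (Ω' x) :=
  ⟨(omegaAtLineCongr F E c N e JV hcδ hδ hd hV hVd hJV h (isCompatible_conjFamily F E c N e JV hcδ hδ hd hV hVd hJV s hc hs)
      hs' a χ).symm.trans (omegaConjEquiv F E c hc N e JV hcδ hδ hd hV hVd hJV hs a χ),
    fun k x => symm_trans_intertwine _ _ _ _ _
      (fun y => omegaAtLineCongr_rhoVAtLine F E c N e JV hcδ hδ hd hV hVd hJV h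
        (isCompatible_conjFamily F E c N e JV hcδ hδ hd hV hVd hJV s hc hs) hs' a χ k y)
      (fun y => omegaConjEquiv_rhoVAtLine F E c hc N e JV hcδ hδ hd hV hVd hJV hs a χ k y) x⟩

/-- abstract bookkeeping, covariant version: `C ∘ Ω` intertwines `ρ₁` with `ρ₃`. [folklore] -/
theorem trans_intertwine {M₁ M₂ M₃ : Type*} [AddCommGroup M₁] [AddCommGroup M₂] [AddCommGroup M₃] [Module ℂ M₁]
    [Module ℂ M₂] [Module ℂ M₃] (Ω : M₁ ≃ₗ[ℂ] M₂) (C : M₂ ≃ₗ[ℂ] M₃) (ρ₁ : M₁ → M₁) (ρ₂ : M₂ → M₂) (ρ₃ : M₃ → M₃)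
    (hΩ : ∀ y, Ω (ρ₁ y) = ρ₂ (Ω y)) (hC : ∀ y, C (ρ₂ y) = ρ₃ (C y)) (x : M₁) :
    (Ω.trans C) (ρ₁ x) = ρ₃ ((Ω.trans C) x) := by
  rw [LinearEquiv.trans_apply, LinearEquiv.trans_apply, hΩ, hC]

/-- **the carrier at EQUAL labels**: `a₁ = a₂`, `χ₁ = χ₂` ⟹ `ω(s; a₁; χ₁) ≃ₗ[ℂ] ω(s; a₂; χ₂)` equivariantly (the identity after `subst`).
[cite: Liu2021, Def. 4.11 (l. 2092–2096)] -/
theorem exists_omegaAtLine_cast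
    {s : ∀ a : Fˣ, adelicPair F E c N 1 JV (JW F E a) →* adelicMpCont F (Fin n) (adelicGram F e TV (TW F a))}
    (hs : ∀ a : Fˣ, (splittingDatum F E c N 1 e JV (JW F E a) hcδ hδ hd hV (isSymm_TW F a) hVd (isUnit_det_TW F a) hJV
      (JW_eq F E a)).IsCompatible (s a)) {a₁ a₂ : Fˣ} (ha : a₁ = a₂) {χ₁ χ₂ : Chi F E c} (hχ : χ₁ = χ₂) :
    ∃ C : omegaAtLine F E c N e JV hcδ hδ hd hV hVd hJV hs a₁ χ₁ ≃ₗ[ℂ] omegaAtLine F E c N e JV hcδ hδ hd hV hVd hJV hs a₂ χ₂,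
      ∀ (k : finAdelic F E c N JV) (x : omegaAtLine F E c N e JV hcδ hδ hd hV hVd hJV hs a₁ χ₁),
        C (rhoVAtLine F E c N e JV hcδ hδ hd hV hVd hJV hs a₁ χ₁ k x) =
          rhoVAtLine F E c N e JV hcδ hδ hd hV hVd hJV hs a₂ χ₂ k (C x) := by
  subst ha hχ
  exact ⟨LinearEquiv.refl ℂ _, fun _ _ => rfl⟩

end Label

section Uniform

/-- `c · c = 1` in `Aut(F/F⁺)` (`IsCMField.orderOf_complexConj`). [folklore] -/
theorem complexConj_mul_complexConj (F : CMField) [IsGalois ℚ F] :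
    IsCMField.complexConj F * IsCMField.complexConj F = 1 := by
  rw [← pow_two, ← IsCMField.orderOf_complexConj F, pow_orderOf_eq_one]

/-- **Ω AT THE μ-UNIFORM FAMILY OF THE MODEL (modulo the label equation of (C3′)).**  See the module docstring.
[cite: Liu2021, Def. 4.11 (l. 2092–2096), Def. 4.12 (l. 2108–2111), Rem. 4.4, App. D Lem. D.1 (2) (l. 5231)] [cite: Kudla1996, V.3] -/
theorem exists_omegaConjEquiv_uniformOmegaRep (h : exists_recordSystem) (F : CMField) [IsGalois ℚ F]
    (ι₁ : F →+* ℂ) (V : HermSpace3 F ι₁) (Φ : CMType F) {n : ℕ} (e : Fin 3 × Fin 1 ≃ Fin n) (dV : Fin 3 → F)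
    (hdV : ∀ i, IsCMField.complexConj F (dV i) = dV i) (hdV0 : ∀ i, dV i ≠ 0)
    (ιV : (sec42DataOf h isoOf F ι₁ V Φ).G →*
      UnitaryGroup.finAdelic ↥(maximalRealSubfield F) F (IsCMField.complexConj F) 3 (Matrix.diagonal dV))
    (δ' : F) (r : ∀ μ : IdeleClassGroup F →ₜ* Circle,
      IdeleClassGroup.IsConjugateSymplectic F μ → Rep ↥(maximalRealSubfield F) (imagUnitSq F))
    (ν : IdeleClassGroup F →ₜ* Circle) (hν : IdeleClassGroup.IsConjugateSymplectic F ν)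
    (hlabel : (fun a => conjFamily ↥(maximalRealSubfield F) F (IsCMField.complexConj F) 3 e (Matrix.diagonal dV)
        (realDiagonal_map F dV hdV).symm
        (fun b => sChiD F e dV hdV hdV0 (toHeckeCharacter F ν) (isUnitary_toHeckeCharacter F ν)
          ((isOscillatorChar_toHeckeCharacter_iff ν).mpr hν) b) a) =
      fun a => sChiD F e dV hdV hdV0 (toHeckeCharacter F (galConj (IsCMField.complexConj F) ν))
        (isUnitary_toHeckeCharacter F (galConj (IsCMField.complexConj F) ν))
        ((isOscillatorChar_toHeckeCharacter_iff (galConj (IsCMField.complexConj F) ν)).mpr hν.galConj) a)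
    {G' : Type*} [Group G'] [TopologicalSpace G']
    (ιV' : G' →* UnitaryGroup.finAdelic ↥(maximalRealSubfield F) F (IsCMField.complexConj F) 3 (Matrix.diagonal dV))
    (φ : (sec42DataOf h isoOf F ι₁ V Φ).G → G')
    (hφ : ∀ g, ιV' (φ g) = finConjV ↥(maximalRealSubfield F) F (IsCMField.complexConj F) 3 (Matrix.diagonal dV)
      (realDiagonal_map F dV hdV).symm (ιV g))
    (ε : (uniformOmegaRep h F ι₁ V Φ e dV hdV hdV0 ιV δ' r).Eps) (χ : (uniformOmegaRep h F ι₁ V Φ e dV hdV hdV0 ιV δ' r).Chi) :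
    ∃ Ω' : (uniformOmegaRep h F ι₁ V Φ e dV hdV hdV0 ιV δ' r).omega (galConj (IsCMField.complexConj F) ν) hν.galConj ε χ ≃ₗ[ℂ]
        omegaAtLine ↥(maximalRealSubfield F) F (IsCMField.complexConj F) 3 e (Matrix.diagonal dV) (complexConj_imagUnit F)
          (imagUnit_ne_zero F) (imagUnit_mul_self F) (realDiagonal_isSymm F dV hdV) (isUnit_det_realDiagonal F dV hdV hdV0)
          (realDiagonal_map F dV hdV).symm
          (hsChiD F e dV hdV hdV0 (toHeckeCharacter F ν) (isUnitary_toHeckeCharacter F ν) ((isOscillatorChar_toHeckeCharacter_iff ν).mpr hν))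
          (-((r (galConj (IsCMField.complexConj F) ν) hν.galConj).toFun ε))
          (chiInv ↥(maximalRealSubfield F) F (IsCMField.complexConj F) χ),
      ∀ (g : (sec42DataOf h isoOf F ι₁ V Φ).G)
        (x : (uniformOmegaRep h F ι₁ V Φ e dV hdV hdV0 ιV δ' r).omega (galConj (IsCMField.complexConj F) ν) hν.galConj ε χ),
        Ω' ((uniformOmegaRep h F ι₁ V Φ e dV hdV hdV0 ιV δ' r).rho (galConj (IsCMField.complexConj F) ν) hν.galConj ε χ g x) =
          rhoAtLine ↥(maximalRealSubfield F) F (IsCMField.complexConj F) 3 e (Matrix.diagonal dV) (complexConj_imagUnit F)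
            (imagUnit_ne_zero F) (imagUnit_mul_self F) (realDiagonal_isSymm F dV hdV) (isUnit_det_realDiagonal F dV hdV hdV0)
            (realDiagonal_map F dV hdV).symm
            (hsChiD F e dV hdV hdV0 (toHeckeCharacter F ν) (isUnitary_toHeckeCharacter F ν) ((isOscillatorChar_toHeckeCharacter_iff ν).mpr hν))
            ιV' (-((r (galConj (IsCMField.complexConj F) ν) hν.galConj).toFun ε))
            (chiInv ↥(maximalRealSubfield F) F (IsCMField.complexConj F) χ) (φ g) (Ω' x) := by
  obtain ⟨Ω', hΩ'⟩ := exists_omegaConjEquiv_of_label ↥(maximalRealSubfield F) F (IsCMField.complexConj F) 3 e (Matrix.diagonal dV) (complexConj_imagUnit F) (imagUnit_ne_zero F) (imagUnit_mul_self F) (realDiagonal_isSymm F dV hdV) (isUnit_det_realDiagonal F dV hdV hdV0) (realDiagonal_map F dV hdV).symm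
    (complexConj_mul_complexConj F)
    (hsChiD F e dV hdV hdV0 (toHeckeCharacter F ν) (isUnitary_toHeckeCharacter F ν) ((isOscillatorChar_toHeckeCharacter_iff ν).mpr hν))
    hlabel
    (hsChiD F e dV hdV hdV0 (toHeckeCharacter F (galConj (IsCMField.complexConj F) ν)) (isUnitary_toHeckeCharacter F (galConj (IsCMField.complexConj F) ν)) ((isOscillatorChar_toHeckeCharacter_iff (galConj (IsCMField.complexConj F) ν)).mpr hν.galConj))
    ((r (galConj (IsCMField.complexConj F) ν) hν.galConj).toFun ε) χ
  refine ⟨Ω', fun g x => ?_⟩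
  -- `𝕌.rho νᶜ … g = rhoVAtLine hsc a χ (ιV g)` by construction (`rfl`), `ιV′ (φ g) = \overline{ιV g}` by `hφ`
  rw [rhoAtLine_apply, hφ]
  exact hΩ' (ιV g) x

end Uniform

section Model

/-- **A7 IN KERNEL FORM AT ONE FRAME (ident-2 spec `OmegaMSpec` 4dd48bba54a0bacb, modulo the label equation `hlabel` of (C3′)).**
For the μ-uniform families of record of TWO face data `(V, Φ, ιV, r)`, `(V′, Φ′, ιV′, r′)` over the SAME real diagonal frame
`(e, dV)`, a homomorphism `φ : 𝔾_V →* 𝔾_{V′}` that is entrywise conjugation through the identifications (`hφ`, wb-10 ✔ `finAdelicConj`),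
sections with `r′_ν(ε′) = −r_{νᶜ}(ε)` (`hε`) and characters `χ′ = χ⁻¹` (`hχ`): `𝕌_V.omega νᶜ _ ε χ ≃ₗ[ℂ] 𝕌_{V′}.omega ν _ ε′ χ′`,
equivariantly along `φ`.  Instance of record ((M), after row B): `V′ := V^{(c)}`, `Φ′ := Φ̄`, `φ := groupConj`,
`ιV′ := (c ⊗ 1) ∘ ιV ∘ groupConj⁻¹`, `r′` with the sign clause — D_BMM's `(μ, ε, χ) ↦ (μᶜ, −ε, χ⁻¹)` read along `g ↦ ḡ`.
[cite: Liu2021, Def. 4.11 (l. 2092–2096), Def. 4.12 (l. 2108–2111), Rem. 4.4, App. D Lem. D.1 (2) (l. 5231)] [cite: Kudla1996, V.3] -/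
theorem exists_uniformOmegaRep_conj (h : exists_recordSystem) (F : CMField) [IsGalois ℚ F] (ι₁ : F →+* ℂ)
    (V V' : HermSpace3 F ι₁) (Φ Φ' : CMType F) {n : ℕ} (e : Fin 3 × Fin 1 ≃ Fin n) (dV : Fin 3 → F)
    (hdV : ∀ i, IsCMField.complexConj F (dV i) = dV i) (hdV0 : ∀ i, dV i ≠ 0)
    (hJc : (Matrix.diagonal dV).map ((IsCMField.complexConj F : F ≃ₐ[↥(maximalRealSubfield F)] F) : F →+* F) =
      Matrix.diagonal dV)
    (ιV : (sec42DataOf h isoOf F ι₁ V Φ).G →*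
      UnitaryGroup.finAdelic ↥(maximalRealSubfield F) F (IsCMField.complexConj F) 3 (Matrix.diagonal dV))
    (ιV' : (sec42DataOf h isoOf F ι₁ V' Φ').G →*
      UnitaryGroup.finAdelic ↥(maximalRealSubfield F) F (IsCMField.complexConj F) 3 (Matrix.diagonal dV))
    (φ : (sec42DataOf h isoOf F ι₁ V Φ).G →* (sec42DataOf h isoOf F ι₁ V' Φ').G) (δ' : F)
    (r r' : ∀ μ : IdeleClassGroup F →ₜ* Circle,
      IdeleClassGroup.IsConjugateSymplectic F μ → Rep ↥(maximalRealSubfield F) (imagUnitSq F))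
    (hφ : ∀ g, ιV' (φ g) = Summit.HodgeConjecture.CorCM.D2Bridge.UnitaryGroupConj.finAdelicConj ↥(maximalRealSubfield F) F
      (IsCMField.complexConj F) 3 hJc (ιV g))
    (ν : IdeleClassGroup F →ₜ* Circle) (hν : IdeleClassGroup.IsConjugateSymplectic F ν)
    (ε ε' : Liu2021.Def411WeilCarriers.Eps ↥(maximalRealSubfield F) (imagUnitSq F))
    (hε : (r' ν hν).toFun ε' = -((r (galConj (IsCMField.complexConj F) ν) hν.galConj).toFun ε))
    (χ χ' : Chi ↥(maximalRealSubfield F) F (IsCMField.complexConj F)) (hχ : χ'.1 = χ.1⁻¹)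
    (hlabel : (fun a => conjFamily ↥(maximalRealSubfield F) F (IsCMField.complexConj F) 3 e (Matrix.diagonal dV)
        (realDiagonal_map F dV hdV).symm
        (fun b => sChiD F e dV hdV hdV0 (toHeckeCharacter F ν) (isUnitary_toHeckeCharacter F ν)
          ((isOscillatorChar_toHeckeCharacter_iff ν).mpr hν) b) a) =
      fun a => sChiD F e dV hdV hdV0 (toHeckeCharacter F (galConj (IsCMField.complexConj F) ν))
        (isUnitary_toHeckeCharacter F (galConj (IsCMField.complexConj F) ν))
        ((isOscillatorChar_toHeckeCharacter_iff (galConj (IsCMField.complexConj F) ν)).mpr hν.galConj) a) :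
    ∃ Ω : (uniformOmegaRep h F ι₁ V Φ e dV hdV hdV0 ιV δ' r).omega (galConj (IsCMField.complexConj F) ν) hν.galConj ε χ ≃ₗ[ℂ]
        (uniformOmegaRep h F ι₁ V' Φ' e dV hdV hdV0 ιV' δ' r').omega ν hν ε' χ',
      ∀ (g : (sec42DataOf h isoOf F ι₁ V Φ).G)
        (x : (uniformOmegaRep h F ι₁ V Φ e dV hdV hdV0 ιV δ' r).omega (galConj (IsCMField.complexConj F) ν) hν.galConj ε χ),
        Ω ((uniformOmegaRep h F ι₁ V Φ e dV hdV hdV0 ιV δ' r).rho (galConj (IsCMField.complexConj F) ν) hν.galConj ε χ g x) =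
          (uniformOmegaRep h F ι₁ V' Φ' e dV hdV hdV0 ιV' δ' r').rho ν hν ε' χ' (φ g) (Ω x) := by
  -- Parts I–V §2: `𝕌_V.omega νᶜ ε χ ≃ ω(sChiD ν; −r_{νᶜ}(ε); χ⁻¹)`, equivariant along `φ` through `ιV′`
  obtain ⟨Ω₁, h₁⟩ := exists_omegaConjEquiv_uniformOmegaRep h F ι₁ V Φ e dV hdV hdV0 ιV δ' r ν hν hlabel ιV' φ (fun g => hφ g) ε χ
  -- the value clauses `hε`, `hχ` move the label `(−r_{νᶜ}(ε), χ⁻¹)` to `(r′_ν(ε′), χ′)`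
  have hχ' : chiInv ↥(maximalRealSubfield F) F (IsCMField.complexConj F) χ = χ' :=
    Subtype.ext (by rw [chiInv_val, hχ])
  obtain ⟨C, hC⟩ := exists_omegaAtLine_cast ↥(maximalRealSubfield F) F (IsCMField.complexConj F) 3 e (Matrix.diagonal dV)
    (complexConj_imagUnit F) (imagUnit_ne_zero F) (imagUnit_mul_self F) (realDiagonal_isSymm F dV hdV)
    (isUnit_det_realDiagonal F dV hdV hdV0) (realDiagonal_map F dV hdV).symm
    (hsChiD F e dV hdV hdV0 (toHeckeCharacter F ν) (isUnitary_toHeckeCharacter F ν) ((isOscillatorChar_toHeckeCharacter_iff ν).mpr hν))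
    hε.symm hχ'
  refine ⟨Ω₁.trans C, fun g x => trans_intertwine Ω₁ C _ _
    ((uniformOmegaRep h F ι₁ V' Φ' e dV hdV hdV0 ιV' δ' r').rho ν hν ε' χ' (φ g)) (h₁ g) (fun y => hC (ιV' (φ g)) y) x⟩

end Model

end Summit.HodgeConjecture.CorCM.HComp.OmegaConj

end
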